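import Mathlib
import Literature.NumberTheory.Irrationality.Fischler2002.BeukersSorokinChangeOfVariables
import HarnessLib

/-!
# Fischler 2002, Corollaire 2.2 (first clause): `B(N) = S(N)` — Beukers' and Sorokin's `ζ(3)` integrals coincide — PROVED

Topic `Literature/NumberTheory/Irrationality/Fischler2002`; proofs-only companion of
`BeukersSorokinChangeOfVariables.lean`, whose NAMED FACT `corollaire22_beukers_eq_sorokin` is DISCHARGED here as
`corollaire22_beukers_eq_sorokin_holds` (cell `pub-zeta5`, seat ct-1 g29, 2026-08-27). Source: S. Fischler,
« Formes linéaires en polyzêtas et intégrales multiples », C. R. Acad. Sci. Paris Sér. I **335** (2002) 1–4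
= arXiv:math/0202064 [Fischler2002Polyzetas], §1–§2 (held text `paper:arxiv-math_0202064`): with
`B(N) = ∫_{[0,1]³} x^N(1−x)^N y^N(1−y)^N z^N(1−z)^N / (1 − z(1−y(1−x)))^{N+1}` (Beukers) and
`S(N) = ∫_{[0,1]³} x^N(1−x)^N y^N(1−y)^N z^N(1−z)^N / ((1−xy)^{N+1}(1−xyz)^{N+1})` (Sorokin), "ces formes linéaires
coïncident. Si on croit à la philosophie des périodes, l'égalité de ces intégrales doit pouvoir se démontrer par une
suite de changements de variables … En l'occurrence, un seul changement de variables suffit (voir le théorème 2.1)",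
**Corollaire 2.2**: "`B(N) = S(N)` pour tout `N ≥ 0`", by the change of variables of Théorème 2.1 at `n = 3`:
`x₁ = X₃`, `x₂ = (1 − X₁)X₂/(1 − X₁X₂)`, `x₃ = X₁`.

HONEST FRAMING (cells pub-zeta5 / zeta5-irr): systematic search; no irrationality claim unless certified. An identity
between triple integrals of non-negative rational functions (a change of variables); nothing here is an irrationality
statement; nothing about `ζ(5)`.

## What is proved, and how (the route of the note at `n = 3`, written out; `theoreme21` itself is NOT used or proved)
In the coordinates of the statement file (`w 0 = x`, `w 1 = y`, `w 2 = z` for `B`; `w 0 = X`, `w 1 = Y`, `w 2 = Z` for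
`S`) the substitution is the map `Φ : (X,Y,Z) ↦ (x,y,z) = (Z, (1−X)Y/(1−XY), X)`, an injective differentiable map of the
open cube `(0,1)³` onto itself (inverse `(x,y,z) ↦ (z, y/(1−z(1−y)), x)`; `bs_image`, `bs_injOn`) with Jacobian determinant
`−(1−X)/(1−XY)²` (`hasFDerivAt_bs`). Under it `1 − y = (1−Y)/(1−XY)` and `1 − z(1−y(1−x)) = (1−X)(1−XYZ)/(1−XY)`
(`bs_one_sub_y`, `bs_delta`), whence the POINTWISE identity `|det| · (Beukers integrand)∘Φ = Sorokin integrand` on the cube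
(`integrand_bs`, by comparing logarithms). Since both sides are lower Lebesgue integrals of `ENNReal.ofReal` of the
integrands, `MeasureTheory.lintegral_image_eq_lintegral_abs_det_fderiv_mul` applies with no integrability hypothesis, and
`[0,1]³` is replaced by `(0,1)³` up to a null set (`Measure.pi_Ioo_ae_eq_pi_Icc`). The maps are written inline; theorems
only, no new definition, no new named fact (net debt −1). Pattern: the tree's `RhinViola2001/ThetaInvarianceProofs.lean`
(same seat) and `BrownZudilin2022/CubicalSubstitutionProofs.lean`.
-/

noncomputable section

namespace Literature.NumberTheory.Irrationality.Fischler2002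

open MeasureTheory Set
open ContinuousLinearMap (proj)
open scoped ENNReal

namespace BeukersSorokin

/-! ### The open cube -/

/-- The open cube `(0,1)³` is measurable. [cite: Fischler2002Polyzetas, §2 Théorème 2.1 (change of variables)] -/
theorem measurableSet_openCube : MeasurableSet (Set.pi Set.univ fun _ : Fin 3 => Ioo (0 : ℝ) 1) :=
  MeasurableSet.univ_pi fun _ => measurableSet_Ioo

/-- `(0,1)³ = [0,1]³` up to a Lebesgue-null set. [cite: Fischler2002Polyzetas, §2 (intégrales sur [0,1]^n)] -/
theorem openCube_ae_eq_unitCube : (Set.pi Set.univ fun _ : Fin 3 => Ioo (0 : ℝ) 1) =ᵐ[volume] unitCube 3 := by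
  rw [unitCube, volume_pi]
  exact Measure.pi_Ioo_ae_eq_pi_Icc (f := fun _ => (0 : ℝ)) (g := fun _ => (1 : ℝ))

/-- Membership in the open cube, coordinatewise. [cite: Fischler2002Polyzetas, §2 Théorème 2.1] -/
theorem mem_openCube {p : Fin 3 → ℝ} :
    p ∈ (Set.pi Set.univ fun _ : Fin 3 => Ioo (0 : ℝ) 1) ↔ ∀ i, 0 < p i ∧ p i < 1 := by
  simp [Set.mem_pi, Set.mem_Ioo]

/-- For `0 < u, v < 1`: `0 < 1 − uv` and `0 < (1−u)v/(1−uv) < 1` (the middle coordinate of `Φ`).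
[cite: Fischler2002Polyzetas, §2 Théorème 2.1] -/
theorem aux_fwd {u v : ℝ} (hu : 0 < u) (hu' : u < 1) (hv : 0 < v) (hv' : v < 1) :
    0 < 1 - u * v ∧ 0 < (1 - u) * v / (1 - u * v) ∧ (1 - u) * v / (1 - u * v) < 1 := by
  have huv : u * v < 1 := by nlinarith
  have hD : 0 < 1 - u * v := by linarith
  refine ⟨hD, div_pos (mul_pos (by linarith) hv) hD, ?_⟩
  rw [div_lt_one hD]
  nlinarith

/-- For `0 < y, z < 1`: `0 < 1 − z(1−y)` and `0 < y/(1 − z(1−y)) < 1` (the middle coordinate of `Φ⁻¹`).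
[cite: Fischler2002Polyzetas, §2 Théorème 2.1] -/
theorem aux_inv {y z : ℝ} (hy : 0 < y) (hy' : y < 1) (hz' : z < 1) :
    0 < 1 - z * (1 - y) ∧ 0 < y / (1 - z * (1 - y)) ∧ y / (1 - z * (1 - y)) < 1 := by
  have h1 : z * (1 - y) < 1 - y := by nlinarith
  have hW : 0 < 1 - z * (1 - y) := by linarith
  refine ⟨hW, div_pos hy hW, ?_⟩
  rw [div_lt_one hW]
  nlinarith

/-- `1 − a/d = (d − a)/d`. [cite: Fischler2002Polyzetas, §2 Théorème 2.1] -/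
theorem one_sub_div' {a d : ℝ} (hd : d ≠ 0) : 1 - a / d = (d - a) / d := by
  field_simp

/-! ### The factors of `B` at `Φ(X,Y,Z)` -/

/-- At `Φ(X,Y,Z)`: `1 − y = (1−Y)/(1−XY)`. [cite: Fischler2002Polyzetas, §2 Théorème 2.1 (n = 3)] -/
theorem bs_one_sub_y {X Y : ℝ} (hD : 1 - X * Y ≠ 0) : 1 - (1 - X) * Y / (1 - X * Y) = (1 - Y) / (1 - X * Y) := by
  rw [one_sub_div' hD]; congr 1; ring

/-- At `Φ(X,Y,Z)`: Beukers' denominator factors, `1 − z(1 − y(1 − x)) = (1−X)(1−XYZ)/(1−XY)`.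
[cite: Fischler2002Polyzetas, §2 Théorème 2.1 (n = 3), Corollaire 2.2] -/
theorem bs_delta {X Y Z : ℝ} (hD : 1 - X * Y ≠ 0) :
    1 - X * (1 - (1 - X) * Y / (1 - X * Y) * (1 - Z)) = (1 - X) * (1 - X * Y * Z) / (1 - X * Y) := by
  rw [div_mul_eq_mul_div, one_sub_div' hD, mul_div_assoc', one_sub_div' hD]
  congr 1
  ring

/-- `Φ⁻¹ ∘ Φ = id`, middle coordinate: `y/(1 − z(1−y)) = Y` at `Φ(X,Y,Z)` (here `z = X`).
[cite: Fischler2002Polyzetas, §2 Théorème 2.1 (n = 3)] -/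
theorem bs_inv_mid {X Y : ℝ} (hD : 1 - X * Y ≠ 0) (hX : 1 - X ≠ 0) :
    (1 - X) * Y / (1 - X * Y) / (1 - X * (1 - (1 - X) * Y / (1 - X * Y))) = Y := by
  have h1 : 1 - X * (1 - (1 - X) * Y / (1 - X * Y)) = (1 - X) / (1 - X * Y) := by
    rw [bs_one_sub_y hD, mul_div_assoc', one_sub_div' hD]
    congr 1
    ring
  rw [h1, div_div_div_cancel_right₀ hD, mul_comm, mul_div_assoc, div_self hX, mul_one]

/-- `Φ ∘ Φ⁻¹ = id`, middle coordinate: `(1−z)·(y/(1−z(1−y)))/(1 − z·y/(1−z(1−y))) = y`.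
[cite: Fischler2002Polyzetas, §2 Théorème 2.1 (n = 3)] -/
theorem bs_fwd_mid {y z : ℝ} (hW : 1 - z * (1 - y) ≠ 0) (hz : 1 - z ≠ 0) :
    (1 - z) * (y / (1 - z * (1 - y))) / (1 - z * (y / (1 - z * (1 - y)))) = y := by
  have h1 : 1 - z * (y / (1 - z * (1 - y))) = (1 - z) / (1 - z * (1 - y)) := by
    rw [mul_div_assoc', one_sub_div' hW]
    congr 1
    ring
  rw [h1, mul_div_assoc', div_div_div_cancel_right₀ hW, mul_comm, mul_div_assoc, div_self hz, mul_one]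

/-! ### `Φ` maps the open cube onto itself, injectively -/

/-- `Φ (X,Y,Z) = (Z, (1−X)Y/(1−XY), X)` maps the open cube into itself. [cite: Fischler2002Polyzetas, §2 Théorème 2.1] -/
theorem bs_mem {p : Fin 3 → ℝ} (hp : p ∈ (Set.pi Set.univ fun _ : Fin 3 => Ioo (0 : ℝ) 1)) :
    ![p 2, (1 - p 0) * p 1 / (1 - p 0 * p 1), p 0] ∈ (Set.pi Set.univ fun _ : Fin 3 => Ioo (0 : ℝ) 1) := by
  rw [mem_openCube] at hp ⊢
  obtain ⟨-, a2, a3⟩ := aux_fwd (hp 0).1 (hp 0).2 (hp 1).1 (hp 1).2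
  intro i
  fin_cases i
  · exact hp 2
  · exact ⟨a2, a3⟩
  · exact hp 0

/-- `Φ⁻¹ (x,y,z) = (z, y/(1−z(1−y)), x)` maps the open cube into itself. [cite: Fischler2002Polyzetas, §2 Théorème 2.1] -/
theorem bsInv_mem {p : Fin 3 → ℝ} (hp : p ∈ (Set.pi Set.univ fun _ : Fin 3 => Ioo (0 : ℝ) 1)) :
    ![p 2, p 1 / (1 - p 2 * (1 - p 1)), p 0] ∈ (Set.pi Set.univ fun _ : Fin 3 => Ioo (0 : ℝ) 1) := by
  rw [mem_openCube] at hp ⊢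
  obtain ⟨-, a2, a3⟩ := aux_inv (hp 1).1 (hp 1).2 (hp 2).2
  intro i
  fin_cases i
  · exact hp 2
  · exact ⟨a2, a3⟩
  · exact hp 0

/-- **`Φ` maps the open cube ONTO itself** (`Φ⁻¹` supplies the preimages). [cite: Fischler2002Polyzetas, §2 Théorème 2.1] -/
theorem bs_image :
    (fun p : Fin 3 → ℝ => ![p 2, (1 - p 0) * p 1 / (1 - p 0 * p 1), p 0]) ''
        (Set.pi Set.univ fun _ : Fin 3 => Ioo (0 : ℝ) 1)
      = (Set.pi Set.univ fun _ : Fin 3 => Ioo (0 : ℝ) 1) := by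
  refine Subset.antisymm ?_ ?_
  · rintro _ ⟨p, hp, rfl⟩; exact bs_mem hp
  · intro p hp
    have hp' := (mem_openCube.1 hp)
    have hW : 1 - p 2 * (1 - p 1) ≠ 0 := (aux_inv (hp' 1).1 (hp' 1).2 (hp' 2).2).1.ne'
    have hz : 1 - p 2 ≠ 0 := by linarith [(hp' 2).2]
    refine ⟨_, bsInv_mem hp, ?_⟩
    ext i
    fin_cases i
    · rfl
    · simp only [Matrix.cons_val_zero, Matrix.cons_val_one, Matrix.cons_val]
      exact bs_fwd_mid hW hz
    · rfl

/-- `Φ` is injective on the open cube. [cite: Fischler2002Polyzetas, §2 Théorème 2.1] -/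
theorem bs_injOn :
    InjOn (fun p : Fin 3 → ℝ => ![p 2, (1 - p 0) * p 1 / (1 - p 0 * p 1), p 0])
      (Set.pi Set.univ fun _ : Fin 3 => Ioo (0 : ℝ) 1) := by
  intro p hp p' hp' h
  have q := mem_openCube.1 hp
  have q' := mem_openCube.1 hp'
  have hD : 1 - p 0 * p 1 ≠ 0 := (aux_fwd (q 0).1 (q 0).2 (q 1).1 (q 1).2).1.ne'
  have hD' : 1 - p' 0 * p' 1 ≠ 0 := (aux_fwd (q' 0).1 (q' 0).2 (q' 1).1 (q' 1).2).1.ne'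
  have hX : 1 - p 0 ≠ 0 := by linarith [(q 0).2]
  have hX' : 1 - p' 0 ≠ 0 := by linarith [(q' 0).2]
  have e0 := congrFun h 0
  have e1 := congrFun h 1
  have e2 := congrFun h 2
  simp only [Matrix.cons_val_zero, Matrix.cons_val_one, Matrix.cons_val] at e0 e1 e2
  -- `e0 : p 2 = p' 2`, `e2 : p 0 = p' 0`, `e1` : the middle coordinates agree
  have k1 : p 1 = p' 1 := by
    have a := bs_inv_mid (Y := p 1) hD hX
    rw [e1, e2] at a
    exact a.symm.trans (bs_inv_mid hD' hX')
  ext i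
  fin_cases i
  · exact e2
  · exact k1
  · exact e0

/-! ### The derivative of `Φ` and its determinant -/

/-- Derivative of the middle coordinate `p ↦ (1−X)Y/(1−XY)`: the row `(−Y(1−Y), 1−X, 0)/(1−XY)²`.
[cite: Fischler2002Polyzetas, §2 Théorème 2.1 (n = 3)] -/
theorem hasFDerivAt_mid (p : Fin 3 → ℝ) (h : 1 - p 0 * p 1 ≠ 0) :
    HasFDerivAt (fun p : Fin 3 → ℝ => (1 - p 0) * p 1 / (1 - p 0 * p 1))
      ((-(p 1 * (1 - p 1)) / (1 - p 0 * p 1) ^ 2) • (proj 0 : (Fin 3 → ℝ) →L[ℝ] ℝ)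
        + ((1 - p 0) / (1 - p 0 * p 1) ^ 2) • (proj 1 : (Fin 3 → ℝ) →L[ℝ] ℝ)) p := by
  have hN : HasFDerivAt (fun p : Fin 3 → ℝ => (1 - p 0) * p 1)
      ((1 - p 0) • (proj 1 : (Fin 3 → ℝ) →L[ℝ] ℝ) + p 1 • (-(proj 0 : (Fin 3 → ℝ) →L[ℝ] ℝ))) p :=
    ((hasFDerivAt_apply (𝕜 := ℝ) 0 p).const_sub 1).mul (hasFDerivAt_apply (𝕜 := ℝ) 1 p)
  have hD : HasFDerivAt (fun p : Fin 3 → ℝ => 1 - p 0 * p 1)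
      (-(p 0 • (proj 1 : (Fin 3 → ℝ) →L[ℝ] ℝ) + p 1 • (proj 0 : (Fin 3 → ℝ) →L[ℝ] ℝ))) p :=
    ((hasFDerivAt_apply (𝕜 := ℝ) 0 p).mul (hasFDerivAt_apply (𝕜 := ℝ) 1 p)).const_sub 1
  have hmul := hN.mul ((hasFDerivAt_inv h).comp p hD)
  refine HasFDerivAt.congr_fderiv (hmul.congr_of_eventuallyEq ?_) ?_
  · exact Filter.Eventually.of_forall fun q => by simp [div_eq_mul_inv]
  · ext v
    simp
    field_simp
    ring

/-- The `3 × 3` determinant with the zero pattern of `DΦ` (a coordinate swap times a `1 × 1` block).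
[cite: Fischler2002Polyzetas, §2 Théorème 2.1 (n = 3)] -/
theorem det_pattern (a b : ℝ) : Matrix.det !![(0 : ℝ), 0, 1; a, b, 0; 1, 0, 0] = -b := by
  rw [Matrix.det_fin_three]
  simp

/-- **`Φ` is differentiable away from the pole `XY = 1`, with Jacobian determinant `−(1−X)/(1−XY)²`.**
[cite: Fischler2002Polyzetas, §2 Théorème 2.1 (n = 3)] -/
theorem hasFDerivAt_bs (p : Fin 3 → ℝ) (hD : 1 - p 0 * p 1 ≠ 0) :
    ∃ f' : (Fin 3 → ℝ) →L[ℝ] (Fin 3 → ℝ),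
      HasFDerivAt (fun p : Fin 3 → ℝ => ![p 2, (1 - p 0) * p 1 / (1 - p 0 * p 1), p 0]) f' p ∧
      f'.det = -((1 - p 0) / (1 - p 0 * p 1) ^ 2) := by
  refine ⟨ContinuousLinearMap.pi
    ![(proj 2 : (Fin 3 → ℝ) →L[ℝ] ℝ),
      ((-(p 1 * (1 - p 1)) / (1 - p 0 * p 1) ^ 2) • (proj 0 : (Fin 3 → ℝ) →L[ℝ] ℝ)
        + ((1 - p 0) / (1 - p 0 * p 1) ^ 2) • (proj 1 : (Fin 3 → ℝ) →L[ℝ] ℝ)),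
      (proj 0 : (Fin 3 → ℝ) →L[ℝ] ℝ)], ?_, ?_⟩
  · refine hasFDerivAt_pi'' fun k => ?_
    rw [ContinuousLinearMap.proj_pi]
    fin_cases k
    · simpa using hasFDerivAt_apply (𝕜 := ℝ) (2 : Fin 3) p
    · simpa using hasFDerivAt_mid p hD
    · simpa using hasFDerivAt_apply (𝕜 := ℝ) (0 : Fin 3) p
  · have hM : LinearMap.toMatrix' ((ContinuousLinearMap.pi
      ![(proj 2 : (Fin 3 → ℝ) →L[ℝ] ℝ),
        ((-(p 1 * (1 - p 1)) / (1 - p 0 * p 1) ^ 2) • (proj 0 : (Fin 3 → ℝ) →L[ℝ] ℝ)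
          + ((1 - p 0) / (1 - p 0 * p 1) ^ 2) • (proj 1 : (Fin 3 → ℝ) →L[ℝ] ℝ)),
        (proj 0 : (Fin 3 → ℝ) →L[ℝ] ℝ)] : (Fin 3 → ℝ) →L[ℝ] (Fin 3 → ℝ)) : (Fin 3 → ℝ) →ₗ[ℝ] (Fin 3 → ℝ))
        = !![(0 : ℝ), 0, 1; (-(p 1 * (1 - p 1)) / (1 - p 0 * p 1) ^ 2), (1 - p 0) / (1 - p 0 * p 1) ^ 2, 0;
             1, 0, 0] := by
      ext i j
      rw [LinearMap.toMatrix'_apply]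
      fin_cases i <;> fin_cases j <;> simp
    rw [ContinuousLinearMap.det, ← LinearMap.det_toMatrix', hM, det_pattern]

/-! ### The pointwise identity of the integrands -/

/-- **Pointwise identity** (the content of the substitution): for `0 < X, Y, Z < 1` and `N ∈ ℕ`,
`(1−X)/(1−XY)² · [x^N(1−x)^N y^N(1−y)^N z^N(1−z)^N/(1 − z(1−y(1−x)))^{N+1}]_{(x,y,z) = Φ(X,Y,Z)}
 = X^N(1−X)^N Y^N(1−Y)^N Z^N(1−Z)^N/((1−XY)^{N+1}(1−XYZ)^{N+1})` — a monomial identity in the positive atoms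
`X, 1−X, Y, 1−Y, Z, 1−Z, 1−XY, 1−XYZ` (`bs_one_sub_y`, `bs_delta`), proved by comparing logarithms.
[cite: Fischler2002Polyzetas, §2 Corollaire 2.2 (first clause)] -/
theorem integrand_bs_coord (N : ℕ) (X Y Z : ℝ) (hX : 0 < X) (hX' : X < 1) (hY : 0 < Y) (hY' : Y < 1)
    (hZ : 0 < Z) (hZ' : Z < 1) :
    (1 - X) / (1 - X * Y) ^ 2 *
        (Z ^ N * (1 - Z) ^ N * ((1 - X) * Y / (1 - X * Y)) ^ N * (1 - (1 - X) * Y / (1 - X * Y)) ^ N * X ^ N *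
            (1 - X) ^ N / (1 - X * (1 - (1 - X) * Y / (1 - X * Y) * (1 - Z))) ^ (N + 1))
      = X ^ N * (1 - X) ^ N * Y ^ N * (1 - Y) ^ N * Z ^ N * (1 - Z) ^ N /
          ((1 - X * Y) ^ (N + 1) * (1 - X * Y * Z) ^ (N + 1)) := by
  have uX : 0 < 1 - X := by linarith
  have uY : 0 < 1 - Y := by linarith
  have uZ : 0 < 1 - Z := by linarith
  have hD : 0 < 1 - X * Y := (aux_fwd hX hX' hY hY').1
  have hXYZ : 0 < 1 - X * Y * Z := by
    have : X * Y * Z < 1 := by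
      have h1 : X * Y < 1 := by nlinarith
      nlinarith [mul_pos (mul_pos hX hY) hZ]
    linarith
  rw [bs_one_sub_y hD.ne', bs_delta hD.ne']
  -- generalize the atoms
  set D := 1 - X * Y with hDdef
  set T := 1 - X * Y * Z with hTdef
  set vX := 1 - X with hvX
  set vY := 1 - Y with hvY
  set vZ := 1 - Z with hvZ
  clear_value D T vX vY vZ
  -- both sides are positive: compare logarithms
  refine (Real.log_injOn_pos.eq_iff ?_ ?_).1 ?_
  · rw [Set.mem_Ioi]; positivity
  · rw [Set.mem_Ioi]; positivity
  simp (disch := positivity) only [Real.log_mul, Real.log_div, Real.log_pow]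
  push_cast
  ring

/-- The pointwise identity on the open cube, in the form used by the change of variables (in `ℝ≥0∞`):
`ofReal |det DΦ(p)| · ofReal (Beukers integrand (Φ p)) = ofReal (Sorokin integrand p)`.
[cite: Fischler2002Polyzetas, §2 Corollaire 2.2 (first clause)] -/
theorem integrand_bs (N : ℕ) {p : Fin 3 → ℝ} (hp : p ∈ (Set.pi Set.univ fun _ : Fin 3 => Ioo (0 : ℝ) 1)) :
    ENNReal.ofReal |-((1 - p 0) / (1 - p 0 * p 1) ^ 2)| *
        ENNReal.ofReal
          ((![p 2, (1 - p 0) * p 1 / (1 - p 0 * p 1), p 0] : Fin 3 → ℝ) 0 ^ N *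
            (1 - (![p 2, (1 - p 0) * p 1 / (1 - p 0 * p 1), p 0] : Fin 3 → ℝ) 0) ^ N *
            (![p 2, (1 - p 0) * p 1 / (1 - p 0 * p 1), p 0] : Fin 3 → ℝ) 1 ^ N *
            (1 - (![p 2, (1 - p 0) * p 1 / (1 - p 0 * p 1), p 0] : Fin 3 → ℝ) 1) ^ N *
            (![p 2, (1 - p 0) * p 1 / (1 - p 0 * p 1), p 0] : Fin 3 → ℝ) 2 ^ N *
            (1 - (![p 2, (1 - p 0) * p 1 / (1 - p 0 * p 1), p 0] : Fin 3 → ℝ) 2) ^ N /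
            (1 - (![p 2, (1 - p 0) * p 1 / (1 - p 0 * p 1), p 0] : Fin 3 → ℝ) 2 *
              (1 - (![p 2, (1 - p 0) * p 1 / (1 - p 0 * p 1), p 0] : Fin 3 → ℝ) 1 *
                (1 - (![p 2, (1 - p 0) * p 1 / (1 - p 0 * p 1), p 0] : Fin 3 → ℝ) 0))) ^ (N + 1))
      = ENNReal.ofReal
          (p 0 ^ N * (1 - p 0) ^ N * p 1 ^ N * (1 - p 1) ^ N * p 2 ^ N * (1 - p 2) ^ N /
            ((1 - p 0 * p 1) ^ (N + 1) * (1 - p 0 * p 1 * p 2) ^ (N + 1))) := by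
  have q := mem_openCube.1 hp
  have hD : 0 < 1 - p 0 * p 1 := (aux_fwd (q 0).1 (q 0).2 (q 1).1 (q 1).2).1
  have hpos : 0 < (1 - p 0) / (1 - p 0 * p 1) ^ 2 := div_pos (by linarith [(q 0).2]) (pow_pos hD 2)
  rw [abs_neg, abs_of_pos hpos, ← ENNReal.ofReal_mul hpos.le]
  congr 1
  simp only [Matrix.cons_val_zero, Matrix.cons_val_one, Matrix.cons_val]
  exact integrand_bs_coord N (p 0) (p 1) (p 2) (q 0).1 (q 0).2 (q 1).1 (q 1).2 (q 2).1 (q 2).2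

/-! ### The change of variables -/

/-- **`B(N) = S(N)` for every `N`** — Beukers' integral is carried to Sorokin's by `Φ` (lower Lebesgue integrals; the
change-of-variables formula for the injective differentiable map `Φ` of the measurable set `(0,1)³` onto itself, and
`[0,1]³ = (0,1)³` a.e.). [cite: Fischler2002Polyzetas, §2 Corollaire 2.2 (first clause)] -/
theorem beukersB_eq_sorokinS (N : ℕ) : beukersB N = sorokinS N := by
  -- a derivative at every point (junk `0` off the cube, where nothing is claimed)
  have hex : ∀ p : Fin 3 → ℝ, ∃ f' : (Fin 3 → ℝ) →L[ℝ] (Fin 3 → ℝ),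
      p ∈ (Set.pi Set.univ fun _ : Fin 3 => Ioo (0 : ℝ) 1) →
      HasFDerivAt (fun p : Fin 3 → ℝ => ![p 2, (1 - p 0) * p 1 / (1 - p 0 * p 1), p 0]) f' p ∧
      f'.det = -((1 - p 0) / (1 - p 0 * p 1) ^ 2) := by
    intro p
    by_cases hp : p ∈ (Set.pi Set.univ fun _ : Fin 3 => Ioo (0 : ℝ) 1)
    · have q := mem_openCube.1 hp
      obtain ⟨f', hf'⟩ := hasFDerivAt_bs p (aux_fwd (q 0).1 (q 0).2 (q 1).1 (q 1).2).1.ne'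
      exact ⟨f', fun _ => hf'⟩
    · exact ⟨0, fun h => (hp h).elim⟩
  choose f' hf' using hex
  have hderiv : ∀ p ∈ (Set.pi Set.univ fun _ : Fin 3 => Ioo (0 : ℝ) 1),
      HasFDerivWithinAt (fun p : Fin 3 → ℝ => ![p 2, (1 - p 0) * p 1 / (1 - p 0 * p 1), p 0]) (f' p)
        (Set.pi Set.univ fun _ : Fin 3 => Ioo (0 : ℝ) 1) p := fun p hp =>
    (hf' p hp).1.hasFDerivWithinAt
  unfold beukersB sorokinS
  rw [← setLIntegral_congr openCube_ae_eq_unitCube, ← setLIntegral_congr openCube_ae_eq_unitCube]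
  have hcv := lintegral_image_eq_lintegral_abs_det_fderiv_mul volume measurableSet_openCube hderiv bs_injOn
    (fun w : Fin 3 → ℝ => ENNReal.ofReal
      ((w 0) ^ N * (1 - w 0) ^ N * (w 1) ^ N * (1 - w 1) ^ N * (w 2) ^ N * (1 - w 2) ^ N /
        (1 - w 2 * (1 - w 1 * (1 - w 0))) ^ (N + 1)))
  rw [bs_image] at hcv
  rw [hcv]
  refine setLIntegral_congr_fun measurableSet_openCube fun p hp => ?_
  rw [(hf' p hp).2]
  exact integrand_bs N hp

end BeukersSorokin

/-- **Fischler's Corollaire 2.2, first clause, holds** (the named fact `corollaire22_beukers_eq_sorokin` is a theorem):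
`B(N) = S(N)` for every `N ≥ 0` — "Beukers' and Sorokin's linear forms in `1, ζ(3)` … coïncident … un seul changement de
variables suffit". [cite: Fischler2002Polyzetas, §2 Corollaire 2.2] -/
theorem corollaire22_beukers_eq_sorokin_holds : corollaire22_beukers_eq_sorokin :=
  fun N => BeukersSorokin.beukersB_eq_sorokinS N

end Literature.NumberTheory.Irrationality.Fischler2002

end
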